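import Mathlib
import Literature.RingTheory.TightClosure.TightClosure
import HarnessLib

/-!
# Every `𝔪`-primary ideal contains a parameter ideal
(crux `FrobeniusLadder.FRationalResolution`, line `Sketch`)

Stub `stub_sop_le_of_mPrimary` (G4) of the skeleton `Sketch` for crux
stmt-ResolutionOfSingularities-15317. In a Noetherian local ring `(R, 𝔪)` of dimension `d`, every
ideal `I ⊇ 𝔪 ^ N` contains an ideal generated by `d` elements `s` whose radical is maximal (a system
of parameters), and this parameter ideal again contains a power of `𝔪`.

Proof: pick any system of parameters `s₀` (`exists_isSystemOfParameters`, in the tree: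
`rad (s₀) = 𝔪`) and put `s i := s₀ i ^ (N + 1)`. Each `s₀ i` lies in `𝔪`, so `s i ∈ 𝔪 ^ (N + 1)
⊆ 𝔪 ^ N ⊆ I`; `(s) ⊆ (s₀)` gives `rad (s) ⊆ 𝔪`, and `s₀ i ∈ rad (s)` gives `𝔪 = rad (s₀) ⊆ rad (s)`;
finally `𝔪` is finitely generated, so some power of it lies in `(s)`
(`Ideal.exists_pow_le_of_le_radical_of_fg`). [Matsumura1987 Thm. 14.1; folklore]
-/

set_option linter.dupNamespace false

namespace Summit.ResolutionOfSingularities.ResolutionOfSingularities.Theorems.FRationalResolution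

open IsLocalRing Literature.RingTheory.TightClosure

/-- EVERY `𝔪`-PRIMARY IDEAL CONTAINS A PARAMETER IDEAL. In a Noetherian local ring `(R, 𝔪)` of
dimension `d`, for every ideal `I ⊇ 𝔪 ^ N` there are `d` elements `s` generating an ideal with
maximal radical (a system of parameters), contained in `I`, and containing a power of `𝔪`: the
`(N + 1)`-st powers of any system of parameters. [Matsumura1987 Thm. 14.1; folklore] -/
theorem stub_sop_le_of_mPrimary (R : Type) [CommRing R] [IsNoetherianRing R] [IsLocalRing R]
    (d : ℕ) (hd : ringKrullDim R = d) (I : Ideal R) (N : ℕ)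
    (hN : IsLocalRing.maximalIdeal R ^ N ≤ I) :
    ∃ s : Fin d → R, (Ideal.span (Set.range s)).radical.IsMaximal ∧ Ideal.span (Set.range s) ≤ I ∧
      ∃ M : ℕ, IsLocalRing.maximalIdeal R ^ M ≤ Ideal.span (Set.range s) := by
  obtain ⟨s₀, -, hrad⟩ := exists_isSystemOfParameters (R := R) hd
  -- `hrad : (Ideal.span (Set.range s₀)).radical = maximalIdeal R`
  -- every member of the system of parameters lies in `𝔪`
  have hs₀m : ∀ i, s₀ i ∈ maximalIdeal R := fun i =>
    hrad.le (Ideal.le_radical (Ideal.subset_span (Set.mem_range_self i)))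
  -- the powers `s₀ i ^ (N + 1)` generate an ideal between `(s₀)` and its radical
  have hle : Ideal.span (Set.range fun i => s₀ i ^ (N + 1)) ≤ Ideal.span (Set.range s₀) := by
    refine Ideal.span_le.mpr ?_
    rintro _ ⟨i, rfl⟩
    exact Ideal.pow_mem_of_mem (Ideal.span (Set.range s₀))
      (Ideal.subset_span (Set.mem_range_self i)) (N + 1) (Nat.succ_pos N)
  have hge : Ideal.span (Set.range s₀) ≤
      (Ideal.span (Set.range fun i => s₀ i ^ (N + 1))).radical := by
    refine Ideal.span_le.mpr ?_
    rintro _ ⟨i, rfl⟩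
    exact ⟨N + 1, Ideal.subset_span (Set.mem_range_self (f := fun i => s₀ i ^ (N + 1)) i)⟩
  -- hence the radical of `(s₀ ^ (N + 1))` is again `𝔪`
  have hrad' : (Ideal.span (Set.range fun i => s₀ i ^ (N + 1))).radical = maximalIdeal R :=
    le_antisymm ((Ideal.radical_mono hle).trans hrad.le)
      (hrad.symm.le.trans (Ideal.radical_le_radical_iff.mpr hge))
  refine ⟨fun i => s₀ i ^ (N + 1), ?_, ?_, ?_⟩
  · -- the radical is `𝔪`, a maximal ideal
    rw [hrad']
    exact maximalIdeal.isMaximal R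
  · -- `(s₀ ^ (N + 1)) ⊆ 𝔪 ^ (N + 1) ⊆ 𝔪 ^ N ⊆ I`
    refine Ideal.span_le.mpr ?_
    rintro _ ⟨i, rfl⟩
    exact hN (Ideal.pow_le_pow_right (Nat.le_succ N) (Ideal.pow_mem_pow (hs₀m i) (N + 1)))
  · -- `𝔪` is finitely generated and contained in the radical of `(s₀ ^ (N + 1))`
    exact Ideal.exists_pow_le_of_le_radical_of_fg hrad'.symm.le (IsNoetherian.noetherian _)

end Summit.ResolutionOfSingularities.ResolutionOfSingularities.Theorems.FRationalResolution
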